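import Summits.QuantumAdvantage.QuantumAdvantage.Theorems.LinnikCubicClassGroupsDegreeOnePrimesEscapePerCharacterDeficitSmoothedBound
import Summits.QuantumAdvantage.QuantumAdvantage.Theorems.LinnikCubicClassGroupsDegreeOnePrimesEscapePerCharacterDeficitUnsmoothing
import Summits.QuantumAdvantage.QuantumAdvantage.Theorems.LinnikCubicClassGroupsDegreeOnePrimesEscapePerCharacterDeficitPartialSummation
import Summits.QuantumAdvantage.QuantumAdvantage.Theorems.LinnikCubicClassGroupsDegreeOnePrimesEscapePerCharacterDeficitDensity
import Summits.QuantumAdvantage.QuantumAdvantage.Theorems.LinnikCubicClassGroupsDegreeOnePrimesEscapePerCharacterDeficitCounting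
import Literature.NumberTheory.LFunctions.UniformClassGroupPNTTransfer
import HarnessLib

/-!
# STUB T4 · `stub_perCharacterDeficit_of_density`: the one-sided per-character deficit from the
# log-free zero-density estimate (line `subgroup-orthogonality-escape`)

Topic `Summits/QuantumAdvantage/QuantumAdvantage/Theorems`, stub `stub_perCharacterDeficit_of_density`
of the line `subgroup-orthogonality-escape` for the crux `DegreeOnePrimesEscape`
(stmt-QuantumAdvantage-11543): `LogFreeDensityCG → PerCharacterDeficitκ`.

**Statement.** Assume the log-free zero-density estimate for the family `{L₀(s,χ)}_{χ ≠ 1}` of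
class group `L`-functions of number fields of every degree (the shape of the tree's
`logFreeDensity_classGroup`). Then for `n > 1` and `A ≥ 0` there is `C₂ = C₂(n, A)` such that for
every `K` of degree `n` with `κ_K ≥ Q^{−A}` (`Q = |d_K| n^n`), every NON-TRIVIAL character `χ` of
`Cl_K` and every `x ≥ Q^{C₂}`:

  `8 · Σ_C Re χ(C) · #{𝔭 ∈ C : N𝔭 prime ≤ x} ≤ Li(x)`.

**Proof (sign-immune Linnik).** In the smoothed explicit formula for `L(s,χ)` every REAL zero
enters `Re` with a non-positive sign and is dropped (no Landau–Page / Siegel / Deuring–Heilbronn);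
the non-real zeros are summed with the field-uniform zero-free region and the density hypothesis
(`re_coefFordK_tzTest_le_mul`: `Re Σ_n Λ_χ(n) g_t(log n) ≤ t/40` for `t ≥ Q^{a₁}`); unsmoothing
of the SIGNED sum with trivial short-interval bounds (`thetaChar_le_re_coefFordK_add`) gives
`Σ_C Re χ(C) θ_C(t) ≤ t/20` for `t ≥ Q^{a₂}`; linear partial summation
(`sum_mul_primeIdealClassCount_le`) transfers this to the signed prime-ideal count, and the primes
of degree `≥ 2` cost `≤ n(√x + 1)` (`primeIdealCount_le_sum_degOneClassCount_add`). The counting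
function `degOneClassCount` of the statement is the one declared (verbatim as in the line skeleton)
in the helper module `…PerCharacterDeficitCounting`.
-/

noncomputable section

open scoped NumberField nonZeroDivisors
open Literature.NumberTheory.LFunctions Literature.NumberTheory.LFunctions.NumberField
  Literature.NumberTheory.LFunctions.TZWeight

namespace Summit.QuantumAdvantage.QuantumAdvantage.Theorems.DegreeOnePrimesEscape

/-! ### The one-sided bound for `T(t) = Σ_C Re χ(C) θ_C(t)` -/

set_option maxHeartbeats 800000 in
open scoped Classical in
/-- **`Σ_C Re χ(C) θ_C(t) ≤ t/20` for `t ≥ Q^{a₂}`**, for every `K` of degree `n > 1` with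
`κ_K ≥ Q^{−A}` and every `χ ≠ 1`, under the log-free density hypothesis (smoothed bound
`re_coefFordK_tzTest_le_mul` at `η = 1/40` + signed unsmoothing + absorption). -/
theorem thetaChar_le_of_density
    (hD : ∀ n : ℕ, ∃ c_D C_D : ℝ, 0 < c_D ∧ 0 < C_D ∧
      ∀ (K : Type) [Field K] [NumberField K], Module.finrank ℚ K = n →
        (∀ χ : ClassGroup (𝓞 K) →* ℂˣ, χ ≠ 1 → ∀ ρ : ℂ,
          Literature.NumberTheory.LFunctions.NumberField.classGroupLFunction₀ K χ ρ = 0 → ρ.re < 1) →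
        ∀ P : ℝ, 2 ≤ P → ((NumberField.discr K).natAbs : ℝ) ≤ P →
          (Fintype.card (ClassGroup (𝓞 K)) : ℝ) ≤ P → P⁻¹ ≤ NumberField.dedekindZeta_residue K →
        ∀ Z : (ClassGroup (𝓞 K) →* ℂˣ) → Finset ℂ,
          (∀ χ : ClassGroup (𝓞 K) →* ℂˣ, χ ≠ 1 → ∀ ρ ∈ Z χ,
              Literature.NumberTheory.LFunctions.NumberField.classGroupLFunction₀ K χ ρ = 0 ∧
                1 / 4 ≤ ρ.re ∧ ρ.re < 1 ∧ |ρ.im| ≤ P) →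
          ∀ α : ℝ, 0 ≤ α → α ≤ 1 →
            ∑ ψ : AddChar (Additive (ClassGroup (𝓞 K))) ℂ with ψ ≠ 0,
              ∑ ρ ∈ Z (Literature.NumberTheory.LFunctions.AbelianDensity.toMulHom ψ).toHomUnits with α ≤ ρ.re,
                (Literature.NumberTheory.LFunctions.LogFreeLocal.zeroOrder
                  (Literature.NumberTheory.LFunctions.NumberField.classGroupLFunction₀ K
                    (Literature.NumberTheory.LFunctions.AbelianDensity.toMulHom ψ).toHomUnits) ρ : ℝ)
                  ≤ C_D * P ^ (c_D * (1 - α)))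
    (n : ℕ) (hn : 1 < n) (A : ℝ) :
    ∃ a₂ : ℝ, 1 ≤ a₂ ∧ ∀ (K : Type) [Field K] [NumberField K], Module.finrank ℚ K = n →
      ThornerZaman.condQn K ^ (-A) ≤ NumberField.dedekindZeta_residue K →
      ∀ χ : ClassGroup (𝓞 K) →* ℂˣ, χ ≠ 1 → ∀ t : ℝ, ThornerZaman.condQn K ^ a₂ ≤ t →
        ∑ C, (χ C : ℂ).re * chebyshevThetaIdealClass K C t ≤ 1 / 20 * t := by
  obtain ⟨c_D, C_D, hc, hC, hdens⟩ := density_oneChar hD n hn A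
  have ha : (1 : ℝ) ≤ max A 4 := le_trans (by norm_num) (le_max_right _ _)
  obtain ⟨ν, a₁, hν0, hν64, ha₁, hsm⟩ :=
    re_coefFordK_tzTest_le_mul n hn hc hC ha (η := 1 / 40) (by norm_num)
  set ℓ : ℝ := 1 / ν * Real.log (44 * ((n : ℝ) + 1) / (ν * (1 / 40))) with hℓ
  refine ⟨max a₁ (max 1 ℓ), le_trans (le_max_left _ _) (le_max_right _ _),
    fun K _ _ hKn hκ χ hχ t ht ↦ ?_⟩
  have hK : 1 < Module.finrank ℚ K := by rw [hKn]; exact hn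
  set Q : ℝ := ThornerZaman.condQn K with hQ
  have hQ12 : (12 : ℝ) ≤ Q := ThornerZaman.twelve_le_condQn (K := K) hK
  have hQ1 : (1 : ℝ) < Q := by linarith
  have ha₂1 : (1 : ℝ) ≤ max a₁ (max 1 ℓ) := le_trans (le_max_left _ _) (le_max_right _ _)
  have hta₁ : Q ^ a₁ ≤ t := le_trans (Real.rpow_le_rpow_of_exponent_le hQ1.le (le_max_left _ _)) ht
  have htQ : Q ≤ t := by
    have : Q ^ (1 : ℝ) ≤ Q ^ max a₁ (max 1 ℓ) := Real.rpow_le_rpow_of_exponent_le hQ1.le ha₂1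
    rw [Real.rpow_one] at this; linarith
  have ht1 : 1 < t := by linarith
  have ht0 : 0 < t := by linarith
  have hlog12 : (2 : ℝ) ≤ Real.log 12 := by
    rw [Real.le_log_iff_exp_le (by norm_num)]
    have := Real.exp_one_lt_d9
    have h : Real.exp 2 = Real.exp 1 * Real.exp 1 := by rw [← Real.exp_add]; norm_num
    rw [h]; nlinarith [Real.exp_pos (1:ℝ)]
  have hlogQ : 2 ≤ Real.log Q := hlog12.trans (Real.log_le_log (by norm_num) hQ12)
  have hlogt : max a₁ (max 1 ℓ) * Real.log Q ≤ Real.log t := by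
    have := Real.log_le_log (by positivity) ht
    rwa [Real.log_rpow (by linarith)] at this
  -- smoothed bound at `t`
  have h1 := hsm K hKn χ hχ (hdens K hKn hκ χ hχ) t hta₁
  -- unsmoothing
  have hε0 : 0 < t ^ (-ν) := Real.rpow_pos_of_pos ht0 _
  have hε1 : t ^ (-ν) ≤ 1 := Real.rpow_le_one_of_one_le_of_nonpos ht1.le (by linarith)
  have h2 := thetaChar_le_re_coefFordK_add (K := K) χ ht1 hε0 hε1
  rw [hKn] at h2
  -- absorption
  have hte : Real.exp 1 ≤ t := by
    have := Real.exp_one_lt_d9; linarith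
  have hlarge : 2 / ν * Real.log (44 * ((n : ℝ) + 1) / (ν * (1 / 40))) ≤ Real.log t := by
    have hℓle : ℓ ≤ max a₁ (max 1 ℓ) := le_trans (le_max_right _ _) (le_max_right _ _)
    have h0 : 0 ≤ max a₁ (max 1 ℓ) := by linarith
    have : 2 * ℓ ≤ Real.log t := by nlinarith
    rw [hℓ] at this
    calc 2 / ν * Real.log (44 * ((n : ℝ) + 1) / (ν * (1 / 40)))
        = 2 * (1 / ν * Real.log (44 * ((n : ℝ) + 1) / (ν * (1 / 40)))) := by ring
      _ ≤ Real.log t := this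
  have h3 := unsmoothing_small (Nat.cast_nonneg n) hν0 (by linarith) (by norm_num : (0:ℝ) < 1 / 40)
    hte hlarge
  linarith

/-! ### The stub -/

set_option maxHeartbeats 800000 in
open scoped Classical in
/-- **STUB T4 · `stub_perCharacterDeficit_of_density`**: `LogFreeDensityCG → PerCharacterDeficitκ`.
The one-sided per-character deficit `8 · Re Σ_{N𝔭 prime ≤ x} χ([𝔭]) ≤ Li(x)` for `x ≥ Q^{C₂}`,
every `K` of degree `n > 1` with `κ_K ≥ Q^{−A}` and every `χ ≠ 1`, from the log-free zero-density
estimate for the class group `L`-functions in every degree. Real zeros are dropped by sign. -/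
theorem stub_perCharacterDeficit_of_density :
    (∀ n : ℕ, ∃ c_D C_D : ℝ, 0 < c_D ∧ 0 < C_D ∧
      ∀ (K : Type) [Field K] [NumberField K], Module.finrank ℚ K = n →
        (∀ χ : ClassGroup (𝓞 K) →* ℂˣ, χ ≠ 1 → ∀ ρ : ℂ,
          Literature.NumberTheory.LFunctions.NumberField.classGroupLFunction₀ K χ ρ = 0 → ρ.re < 1) →
        ∀ P : ℝ, 2 ≤ P → ((NumberField.discr K).natAbs : ℝ) ≤ P →
          (Fintype.card (ClassGroup (𝓞 K)) : ℝ) ≤ P → P⁻¹ ≤ NumberField.dedekindZeta_residue K →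
        ∀ Z : (ClassGroup (𝓞 K) →* ℂˣ) → Finset ℂ,
          (∀ χ : ClassGroup (𝓞 K) →* ℂˣ, χ ≠ 1 → ∀ ρ ∈ Z χ,
              Literature.NumberTheory.LFunctions.NumberField.classGroupLFunction₀ K χ ρ = 0 ∧
                1 / 4 ≤ ρ.re ∧ ρ.re < 1 ∧ |ρ.im| ≤ P) →
          ∀ α : ℝ, 0 ≤ α → α ≤ 1 →
            ∑ ψ : AddChar (Additive (ClassGroup (𝓞 K))) ℂ with ψ ≠ 0,
              ∑ ρ ∈ Z (Literature.NumberTheory.LFunctions.AbelianDensity.toMulHom ψ).toHomUnits with α ≤ ρ.re,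
                (Literature.NumberTheory.LFunctions.LogFreeLocal.zeroOrder
                  (Literature.NumberTheory.LFunctions.NumberField.classGroupLFunction₀ K
                    (Literature.NumberTheory.LFunctions.AbelianDensity.toMulHom ψ).toHomUnits) ρ : ℝ)
                  ≤ C_D * P ^ (c_D * (1 - α))) →
    ∀ n : ℕ, 1 < n → ∀ A : ℝ, 0 ≤ A → ∃ C₂ : ℝ, ∀ (K : Type) [Field K] [NumberField K],
      Module.finrank ℚ K = n →
      Literature.NumberTheory.LFunctions.NumberField.ThornerZaman.condQn K ^ (-A) ≤
        NumberField.dedekindZeta_residue K →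
      ∀ χ : ClassGroup (𝓞 K) →* ℂˣ, χ ≠ 1 → ∀ x : ℝ,
      Literature.NumberTheory.LFunctions.NumberField.ThornerZaman.condQn K ^ C₂ ≤ x →
        8 * ∑ C : ClassGroup (𝓞 K), ((χ C : ℂ)).re * (degOneClassCount K C x : ℝ) ≤
          Literature.NumberTheory.LFunctions.offsetLogIntegral x := by
  intro hD n hn A _
  obtain ⟨a₂, ha₂, hθ⟩ := thetaChar_le_of_density hD n hn A
  refine ⟨max (2 * a₂) (4 * n + 16), fun K _ _ hKn hκ χ hχ x hx ↦ ?_⟩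
  have hK : 1 < Module.finrank ℚ K := by rw [hKn]; exact hn
  set Q : ℝ := ThornerZaman.condQn K with hQ
  have hQ12 : (12 : ℝ) ≤ Q := ThornerZaman.twelve_le_condQn (K := K) hK
  have hQ1 : (1 : ℝ) < Q := by linarith
  set C₂ : ℝ := max (2 * a₂) (4 * n + 16) with hC₂
  -- `Y = Q^{a₂}`, `Y² ≤ x`
  set Y : ℝ := Q ^ a₂ with hY
  have hYQ : Q ≤ Y := by
    have : Q ^ (1 : ℝ) ≤ Q ^ a₂ := Real.rpow_le_rpow_of_exponent_le hQ1.le ha₂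
    rwa [Real.rpow_one] at this
  have hY2 : (2 : ℝ) ≤ Y := by linarith
  have hY0 : 0 < Y := by linarith
  have hYYx : Y * Y ≤ x := by
    have : Q ^ (2 * a₂) ≤ Q ^ C₂ := Real.rpow_le_rpow_of_exponent_le hQ1.le (le_max_left _ _)
    rw [show (2 : ℝ) * a₂ = a₂ + a₂ by ring, Real.rpow_add (by linarith)] at this
    exact this.trans hx
  have hYx : Y ≤ x := by nlinarith
  have hYsqrt : Y ≤ Real.sqrt x := by
    rw [Real.le_sqrt hY0.le (by nlinarith)]; nlinarith
  -- `x ≥ 12^{4n+16} ≥ (10⁴(n+1))⁴`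
  have hxbig : (10000 * ((n:ℝ) + 1)) ^ 4 ≤ x := by
    have h1 : Q ^ ((4 * n + 16 : ℕ) : ℝ) ≤ x := by
      refine le_trans (Real.rpow_le_rpow_of_exponent_le hQ1.le ?_) hx
      push_cast; exact le_max_right _ _
    rw [Real.rpow_natCast] at h1
    have h2 : (12 : ℝ) ^ (4 * n + 16) ≤ Q ^ (4 * n + 16) := pow_le_pow_left₀ (by norm_num) hQ12 _
    have h3 : ((10000 * (n + 1)) ^ 4 : ℕ) ≤ 12 ^ (4 * n + 16) := pow_bound_twelve n
    have h4 : (((10000 * (n + 1)) ^ 4 : ℕ) : ℝ) ≤ ((12 ^ (4 * n + 16) : ℕ) : ℝ) := by exact_mod_cast h3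
    push_cast at h4
    linarith
  have hsize := size_ineq_deficit n hxbig
  have hn0 : (0 : ℝ) ≤ n := Nat.cast_nonneg n
  have hx256 : (256 : ℝ) ≤ x := by
    have h1 : (10000 : ℝ) ≤ 10000 * ((n : ℝ) + 1) := by nlinarith
    have h2 : (10000 : ℝ) ^ 4 ≤ (10000 * ((n : ℝ) + 1)) ^ 4 := pow_le_pow_left₀ (by norm_num) h1 4
    linarith [show (256 : ℝ) ≤ 10000 ^ 4 by norm_num]
  have hx0 : 0 ≤ x := by linarith
  have hx1 : 1 < x := by linarith
  have hlogx : 0 < Real.log x := Real.log_pos hx1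
  -- the θ-bound on `[Y, x]` and Chebyshev below `Y`
  have hup : ∀ t ∈ Set.Icc Y x, ∑ C, (χ C : ℂ).re * chebyshevThetaIdealClass K C t ≤ 1 / 20 * t :=
    fun t ht ↦ hθ K hKn hκ χ hχ t ht.1
  have hBt : ∀ t ∈ Set.Icc 2 Y, chebyshevThetaIdeal K t ≤ (n * (Real.log 4 + 4)) * t := by
    intro t ht
    have := chebyshevThetaIdeal_le_mul K (by linarith [ht.1] : (0:ℝ) ≤ t)
    rw [hKn] at this; exact this
  have hlog4 : Real.log 4 < 2 := by
    have : Real.log 4 = 2 * Real.log 2 := by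
      rw [show (4:ℝ) = 2 ^ 2 by norm_num, Real.log_pow]; norm_num
    rw [this]; have := Real.log_two_lt_d9; linarith
  have hB0 : 0 ≤ (n : ℝ) * (Real.log 4 + 4) := by
    have : 0 ≤ Real.log 4 := Real.log_nonneg (by norm_num)
    positivity
  -- partial summation for the signed count
  have hre1 : ∀ C : ClassGroup (𝓞 K), |((χ C : ℂ)).re| ≤ 1 := fun C ↦ abs_re_classGroupChar_le χ C
  have hPS := sum_mul_primeIdealClassCount_le (K := K) (fun C ↦ (χ C : ℂ).re) hre1 hY2 hYx
    (by norm_num : (0:ℝ) ≤ 1 / 20) hB0 hup hBt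
  -- degree-one counts versus all primes, class by class
  have hS := sum_re_mul_le_add (fun C : ClassGroup (𝓞 K) => ((χ C : ℂ)).re)
    (fun C => (degOneClassCount K C x : ℝ)) (fun C => (primeIdealClassCount K C x : ℝ)) hre1
    (fun C => by exact_mod_cast degOneClassCount_le K C x)
  beta_reduce at hS
  have hdeg := primeIdealCount_le_sum_degOneClassCount_add K hx0
  rw [hKn] at hdeg
  have htot : (primeIdealCount K x : ℝ) = ∑ C : ClassGroup (𝓞 K), (primeIdealClassCount K C x : ℝ) := by
    rw [← sum_primeIdealClassCount (K := K) x]; push_cast; rfl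
  -- `Li(x) ≥ x/(2 log x)`
  have hLi : x / (2 * Real.log x) ≤ offsetLogIntegral x := div_two_mul_log_le_offsetLogIntegral hx256
  -- assembly
  have hsqrt0 : 0 ≤ Real.sqrt x := Real.sqrt_nonneg _
  have hns0 : 0 ≤ (n : ℝ) * Real.sqrt x := mul_nonneg hn0 hsqrt0
  have hBY : 3 * ((n : ℝ) * (Real.log 4 + 4)) * Y ≤ 18 * ((n : ℝ) * Real.sqrt x) := by
    have h1 : (n : ℝ) * (Real.log 4 + 4) ≤ 6 * n := by nlinarith
    have h2 : 3 * ((n : ℝ) * (Real.log 4 + 4)) * Y ≤ 3 * (6 * n) * Y :=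
      mul_le_mul_of_nonneg_right (by linarith) hY0.le
    have h3 : 3 * (6 * (n : ℝ)) * Y ≤ 3 * (6 * n) * Real.sqrt x :=
      mul_le_mul_of_nonneg_left hYsqrt (by positivity)
    linarith
  have hxlog : x / (2 * Real.log x) = 1 / 2 * (x / Real.log x) := by ring
  rw [hxlog] at hLi
  have e1 : (n : ℝ) * (Real.sqrt x + 1) = n * Real.sqrt x + n := by ring
  rw [e1] at hdeg
  linarith [hS, hPS, hdeg, htot, hLi, hsize, hBY, hsqrt0, hn0, hns0]

end Summit.QuantumAdvantage.QuantumAdvantage.Theorems.DegreeOnePrimesEscape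

end
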